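import Summits.KontsevichZagierPeriods.Zeta5Search.Certificates.RecordRayStepTail
import Summits.KontsevichZagierPeriods.Zeta5Search.Certificates.RecordRayDenominatorsBricksClassH
import HarnessLib

/-!
# ζ(5) search — the record ray's DENOMINATORS, XIII-b: the table theorem of a SOUND window list WITH THE UNIFORM BRICK TAIL (p3 g7)

HONEST FRAMING: systematic search; no irrationality claim unless certified.  Valuation bookkeeping of explicit rationals; every
exponent this yields in the cell is `< 1` — a calibration, nothing about the arithmetic nature of `ζ(5)`.

OUR work (Summit side; prover seat p3, generation 7).  Sequel of `RecordRayDenominatorsBricksLaw` (`BWin.Sound`, `SoundList`,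
`ML l n = M0 n / Φ_n(l)`, `record_exponent_of_sound`), `RecordRayDenominatorsBricksClassH` (`ok4`, `record_exponent_of_table4`) and
`RecordRayStepTail` (`BrickTail.tailFactor`, `tailFactor_dvd`, `eventually_exp_le_tailFactor`, rate `≥ 0.3046`):
* `MLT l n = ML l n / tailFactor n`; `coprime_corrL_tailFactor` (the window product and the tail factor are coprime: a window of a
  sound list has `θ > 1/16` by `okShape`, a prime of the tail factor has `16p ≤ n`); `MLT_mul_recordP_int`, `MLT_mul_recordQ_int`
  (`n ≥ 11849`); `eventually_MLT_le_exp` (rate `381.5232 − rateQ l − 0.3046`);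
* **`record_exponent_of_sound_tail`** / **`record_exponent_of_table4_tail`** — for a sound (resp. `ok4`-checked), chain-separated
  list `l`, every `γ ≥ 0` with `γ·((381.5232 − rateQ l − 0.3046) + 0.02 + 85.08768884) < 85.08768883 + 31.5452` is a hypothesis-free
  effective exponent of Brown–Zudilin's approximations with the integers `p_n = MLT l n·P_n`, `q_n = MLT l n·|Q(a·n)|`.
The instance on the D16 table (`0.8583 → 0.8603`) is file `RecordRayDenominatorsBricksD16Tail`.
-/

noncomputable section

open Finset Real Filter Topology

namespace Summit.KontsevichZagierPeriods.Zeta5Search.RecordRay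

open Summit.KontsevichZagierPeriods.Zeta5Search.DualSeries
open Summit.KontsevichZagierPeriods.Zeta5Search.DualSeriesDenominators
open Summit.KontsevichZagierPeriods.Zeta5Search.WedgeDictionary
open Summit.KontsevichZagierPeriods.Zeta5Search.DualSeriesLemma19 (bRecord)
open Literature.NumberTheory.Irrationality.Hata1992
open Literature.NumberTheory.Transcendental (zetaValue)

namespace BrickAtlas

open BrickTail

variable {l : List BWin}

/-- **The multiplier with the uniform tail**: `MLT l n = ML l n / tailFactor n`. -/
def MLT (l : List BWin) (n : ℕ) : ℚ := ML l n / (tailFactor n : ℚ)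

/-- `0 < MLT l n`. -/
theorem MLT_pos (l : List BWin) (n : ℕ) : 0 < MLT l n :=
  div_pos (ML_pos l n) (by exact_mod_cast tailFactor_pos n)

/-- The window product of a sound list and the tail factor are coprime: every window lies above `θ = 1/16` (`okShape`: `a₂ ≤ 16a₁`),
every prime of the tail factor has `16p ≤ n`. -/
theorem coprime_corrL_tailFactor (hS : SoundList l) (n : ℕ) : Nat.Coprime (corrL l n) (tailFactor n) := by
  classical
  apply Nat.coprime_of_dvd
  intro q hq hq1 hq2
  have h16 := le_of_dvd_tailFactor hq hq2
  unfold corrL multiWindowProd at hq1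
  haveI := Fact.mk hq
  obtain ⟨i, -, hi⟩ := ((Nat.prime_iff.1 hq).dvd_finsetProd_iff _).1 hq1
  have hi' : q ∣ windowProd (AL l i) (BL l i) n := hq.dvd_of_dvd_pow hi
  have hmem : q ∈ windowPrimes (AL l i) (BL l i) n := by
    have hv := one_le_padicValNat_of_dvd (windowProd_pos _ _ _).ne' hi'
    rw [padicValNat_windowProd hq] at hv
    split_ifs at hv with h
    · exact h
    · exact absurd hv (by norm_num)
  obtain ⟨hshape, -⟩ := hS i
  obtain ⟨-, hlo, -⟩ := (mem_windowPrimes_iff (AL_le_BL_s hS i (mem_univ _)).1).1 hmem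
  have hlo' : (l[i]).a1 * n < (l[i]).a2 * q := BWin.lo_nat_of_okShape hshape hlo
  simp only [BWin.okShape, Bool.and_eq_true, decide_eq_true_eq] at hshape
  obtain ⟨⟨⟨⟨⟨ha1, -⟩, -⟩, -⟩, h8⟩, -⟩ := hshape
  have : (l[i]).a1 * n < (l[i]).a1 * (16 * q) := by nlinarith
  have := Nat.lt_of_mul_lt_mul_left this
  omega

/-- **`MLT l n · P_n ∈ ℤ`** for a sound, chain-separated list (`n ≥ 11849`). -/
theorem MLT_mul_recordP_int (hS : SoundList l) (hch : chainSep l = true) {n : ℕ} (hn : 11849 ≤ n) :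
    ∃ z : ℤ, MLT l n * recordP n = z := by
  classical
  have hn1 : 1 ≤ n := by omega
  have hn0 : 10496 ≤ n := by omega
  obtain ⟨⟨zU, hzU⟩, ⟨zW, hzW⟩, ⟨zV, hzV⟩, ⟨zU', hzU'⟩, ⟨zW', hzW'⟩, ⟨zV', hzV'⟩⟩ := sharp_ints hn1
  obtain ⟨s, -, hρ⟩ := exists_sign_mul_abs _ (rhoOf_aRec_ne_zero n)
  have habs : |rhoOf (aRec n)| ≠ 0 := abs_ne_zero.2 (rhoOf_aRec_ne_zero n)
  have hdiv : rhoOf (aRec n) / |rhoOf (aRec n)| = s := by rw [div_eq_iff habs]; exact hρ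
  have key : M0 n * recordP n = (rhoOf (aRec n) / |rhoOf (aRec n)|) *
      ((dRec n ^ 3 * sharpNormaliser (bRecord' n) * coeffW (bRecord' n)) *
      (dRec n ^ 6 * sharpNormaliser (bRecord n) * coeffV (bRecord n)) -
      (dRec n ^ 3 * sharpNormaliser (bRecord n) * coeffW (bRecord n)) *
      (dRec n ^ 6 * sharpNormaliser (bRecord' n) * coeffV (bRecord' n))) := by
    unfold M0 recordP
    field_simp
  rw [hdiv, hzW, hzV, hzW', hzV'] at key
  have hdvd1 : ((corrL l n : ℕ) : ℤ) ∣ (zW' * zV - zW * zV') := by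
    apply multiWindowProd_dvd_int
    · intro i hi p hp
      exact ((dvdL_s hS hn0 hzW hzV hzW' hzV' hzU hzU') i hi p hp).1
    · exact disjointL_s hS hch n
  have hdvd2 : ((tailFactor n : ℕ) : ℤ) ∣ (zW' * zV - zW * zV') := (tailFactor_dvd hn hzW hzV hzW' hzV' hzU hzU').1
  have hcop := coprime_corrL_tailFactor hS n
  have hdvd : ((corrL l n * tailFactor n : ℕ) : ℤ) ∣ (zW' * zV - zW * zV') := by
    push_cast; exact (Nat.isCoprime_iff_coprime.2 hcop).mul_dvd hdvd1 hdvd2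
  obtain ⟨q, hq⟩ := hdvd
  refine ⟨s * q, ?_⟩
  have hc : (corrL l n : ℚ) ≠ 0 := by exact_mod_cast (corrL_pos l n).ne'
  have ht : (tailFactor n : ℚ) ≠ 0 := by exact_mod_cast (tailFactor_pos n).ne'
  have e : (zW' : ℚ) * zV - zW * zV' = ((corrL l n : ℚ) * (tailFactor n : ℚ)) * q := by exact_mod_cast hq
  calc MLT l n * recordP n = M0 n * recordP n / ((corrL l n : ℚ) * (tailFactor n : ℚ)) := by
        unfold MLT ML; rw [div_div]; ring
    _ = s * ((zW' : ℚ) * zV - zW * zV') / ((corrL l n : ℚ) * (tailFactor n : ℚ)) := by rw [key]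
    _ = ((s * q : ℤ) : ℚ) := by rw [e]; push_cast; field_simp

/-- **`MLT l n · Q(a·n) ∈ ℤ`** for a sound, chain-separated list (`n ≥ 11849`). -/
theorem MLT_mul_recordQ_int (hS : SoundList l) (hch : chainSep l = true) {n : ℕ} (hn : 11849 ≤ n) :
    ∃ z : ℤ, MLT l n * recordQ n = z := by
  classical
  have hn1 : 1 ≤ n := by omega
  have hn0 : 10496 ≤ n := by omega
  obtain ⟨⟨zU, hzU⟩, ⟨zW, hzW⟩, ⟨zV, hzV⟩, ⟨zU', hzU'⟩, ⟨zW', hzW'⟩, ⟨zV', hzV'⟩⟩ := sharp_ints hn1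
  obtain ⟨s, -, hρ⟩ := exists_sign_mul_abs _ (rhoOf_aRec_ne_zero n)
  have habs : |rhoOf (aRec n)| ≠ 0 := abs_ne_zero.2 (rhoOf_aRec_ne_zero n)
  have hdiv : rhoOf (aRec n) / |rhoOf (aRec n)| = s := by rw [div_eq_iff habs]; exact hρ
  have hQ := recordQ_eq_wedge hn1
  have key : M0 n * recordQ n = (rhoOf (aRec n) / |rhoOf (aRec n)|) * dRec n ^ 5 *
      ((dRec n * sharpNormaliser (bRecord n) * coeffU (bRecord n)) *
      (dRec n ^ 3 * sharpNormaliser (bRecord' n) * coeffW (bRecord' n)) -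
      (dRec n * sharpNormaliser (bRecord' n) * coeffU (bRecord' n)) *
      (dRec n ^ 3 * sharpNormaliser (bRecord n) * coeffW (bRecord n))) := by
    unfold M0
    rw [hQ]
    field_simp
  rw [hdiv, hzU, hzW, hzU', hzW'] at key
  set D : ℤ := (Nat.lcmUpto (41 * n) : ℤ) with hD
  have hdvd1 : ((corrL l n : ℕ) : ℤ) ∣ (D ^ 5 * (zU * zW') - D ^ 5 * (zU' * zW)) := by
    apply multiWindowProd_dvd_int
    · intro i hi p hp
      exact ((dvdL_s hS hn0 hzW hzV hzW' hzV' hzU hzU') i hi p hp).2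
    · exact disjointL_s hS hch n
  have hdvd2 : ((tailFactor n : ℕ) : ℤ) ∣ (D ^ 5 * (zU * zW') - D ^ 5 * (zU' * zW)) :=
    (tailFactor_dvd hn hzW hzV hzW' hzV' hzU hzU').2
  have hcop := coprime_corrL_tailFactor hS n
  have hdvd : ((corrL l n * tailFactor n : ℕ) : ℤ) ∣ (D ^ 5 * (zU * zW') - D ^ 5 * (zU' * zW)) := by
    push_cast; exact (Nat.isCoprime_iff_coprime.2 hcop).mul_dvd hdvd1 hdvd2
  obtain ⟨q, hq⟩ := hdvd
  refine ⟨s * q, ?_⟩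
  have hc : (corrL l n : ℚ) ≠ 0 := by exact_mod_cast (corrL_pos l n).ne'
  have ht : (tailFactor n : ℚ) ≠ 0 := by exact_mod_cast (tailFactor_pos n).ne'
  have hDq : (D : ℚ) = dRec n := by rw [hD]; unfold dRec; push_cast; rfl
  have e : (dRec n) ^ 5 * ((zU : ℚ) * zW' - zU' * zW) = ((corrL l n : ℚ) * (tailFactor n : ℚ)) * q := by
    rw [← hDq]
    exact_mod_cast (by rw [← hq]; ring : D ^ 5 * (zU * zW' - zU' * zW) = ((corrL l n * tailFactor n : ℕ) : ℤ) * q)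
  calc MLT l n * recordQ n = M0 n * recordQ n / ((corrL l n : ℚ) * (tailFactor n : ℚ)) := by
        unfold MLT ML; rw [div_div]; ring
    _ = s * (dRec n ^ 5 * ((zU : ℚ) * zW' - zU' * zW)) / ((corrL l n : ℚ) * (tailFactor n : ℚ)) := by rw [key]; ring
    _ = ((s * q : ℤ) : ℚ) := by rw [e]; push_cast; field_simp

/-- **Size with the tail**: for every `ε > 0`, eventually `MLT l n ≤ e^{((381.5232 − rateQ l) − 0.3046 + ε)·n}`. -/
theorem eventually_MLT_le_exp (hS : SoundList l) {ε : ℝ} (hε : 0 < ε) :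
    ∀ᶠ n : ℕ in atTop, ((MLT l n : ℚ) : ℝ) ≤ Real.exp ((((3815232 / 10000 - rateQ l : ℚ) : ℝ) - 3046 / 10000 + ε) * n) := by
  have hε2 : 0 < ε / 2 := by positivity
  filter_upwards [eventually_ML_le_exp_s hS hε2, eventually_exp_le_tailFactor hε2] with n h1 h2
  have htpos : (0 : ℝ) < ((tailFactor n : ℕ) : ℝ) := by exact_mod_cast tailFactor_pos n
  have hcast : ((MLT l n : ℚ) : ℝ) = ((ML l n : ℚ) : ℝ) / ((tailFactor n : ℕ) : ℝ) := by
    unfold MLT; push_cast; rfl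
  rw [hcast, div_le_iff₀ htpos]
  calc ((ML l n : ℚ) : ℝ) ≤ Real.exp ((((3815232 / 10000 - rateQ l : ℚ)) + ε / 2) * n) := h1
    _ = Real.exp ((((3815232 / 10000 - rateQ l : ℚ) : ℝ) - 3046 / 10000 + ε) * n) * Real.exp ((3046 / 10000 - ε / 2) * n) := by
        rw [← Real.exp_add]; ring_nf
    _ ≤ Real.exp ((((3815232 / 10000 - rateQ l : ℚ) : ℝ) - 3046 / 10000 + ε) * n) * ((tailFactor n : ℕ) : ℝ) :=
        mul_le_mul_of_nonneg_left h2 (Real.exp_pos _).le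

/-- **THE EXPONENT OF A SOUND TABLE WITH THE UNIFORM TAIL, hypothesis-free.**  For a sound, chain-separated list `l` and every
`γ ≥ 0` with `γ·((381.5232 − rateQ l − 0.3046) + 0.02 + 85.08768884) < 85.08768883 + 31.5452`: eventually
`|ζ(5) − P_n/Q(a·n)| < 1/q_n^γ` with the integers `p_n = MLT l n·P_n`, `q_n = MLT l n·|Q(a·n)| ≥ 1`.  No irrationality content
for `γ < 1`. -/
theorem record_exponent_of_sound_tail (hS : SoundList l) (hch : chainSep l = true) {γ : ℝ} (hγ0 : 0 ≤ γ)
    (hγ : γ * ((((3815232 / 10000 - rateQ l - 3046 / 10000 : ℚ) : ℝ) + 2 / 100) + 8508768884 / 10 ^ 8) <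
      8508768883 / 10 ^ 8 + 315452 / 10000) :
    ∀ᶠ n : ℕ in atTop, ∃ p : ℤ, ∃ q : ℕ, 1 ≤ q ∧ (q : ℚ) = MLT l n * |(recordQ n : ℚ)| ∧ (p : ℚ) = MLT l n * recordP n ∧
      |zetaValue 5 - (recordP n : ℝ) / (recordQ n : ℝ)| < 1 / (q : ℝ) ^ γ := by
  have hq : (((3815232 / 10000 - rateQ l - 3046 / 10000 : ℚ)) : ℝ) = (((3815232 / 10000 - rateQ l : ℚ)) : ℝ) - 3046 / 10000 := by
    push_cast; ring
  rw [hq] at hγ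
  refine record_exponent_rat (lam := (((3815232 / 10000 - rateQ l : ℚ)) : ℝ) - 3046 / 10000 + 2 / 100) (MLT l) ?_ hγ0
    (by linarith)
  filter_upwards [eventually_MLT_le_exp hS (show (0 : ℝ) < 2 / 100 by norm_num), eventually_ge_atTop 11849] with n hn hnN
  exact ⟨MLT_pos l n, MLT_mul_recordP_int hS hch hnN, MLT_mul_recordQ_int hS hch hnN, hn⟩

/-- **The exponent of a table checked by `ok4`, with the uniform tail.** -/
theorem record_exponent_of_table4_tail {cw : List CWin} (hcw : ∀ c ∈ cw, c.Holds) (hok : l.all (BWin.ok4 cw) = true)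
    (hch : chainSep l = true) {γ : ℝ} (hγ0 : 0 ≤ γ)
    (hγ : γ * ((((3815232 / 10000 - rateQ l - 3046 / 10000 : ℚ) : ℝ) + 2 / 100) + 8508768884 / 10 ^ 8) <
      8508768883 / 10 ^ 8 + 315452 / 10000) :
    ∀ᶠ n : ℕ in atTop, ∃ p : ℤ, ∃ q : ℕ, 1 ≤ q ∧ (q : ℚ) = MLT l n * |(recordQ n : ℚ)| ∧ (p : ℚ) = MLT l n * recordP n ∧
      |zetaValue 5 - (recordP n : ℝ) / (recordQ n : ℝ)| < 1 / (q : ℝ) ^ γ :=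
  record_exponent_of_sound_tail (soundList_of_all_ok4 hcw hok) hch hγ0 hγ

/-- **The exponent of a table checked by `ok2` (no class-law windows), with the uniform tail.** -/
theorem record_exponent_of_table2_tail (hok : l.all BWin.ok2 = true) (hch : chainSep l = true) {γ : ℝ} (hγ0 : 0 ≤ γ)
    (hγ : γ * ((((3815232 / 10000 - rateQ l - 3046 / 10000 : ℚ) : ℝ) + 2 / 100) + 8508768884 / 10 ^ 8) <
      8508768883 / 10 ^ 8 + 315452 / 10000) :
    ∀ᶠ n : ℕ in atTop, ∃ p : ℤ, ∃ q : ℕ, 1 ≤ q ∧ (q : ℚ) = MLT l n * |(recordQ n : ℚ)| ∧ (p : ℚ) = MLT l n * recordP n ∧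
      |zetaValue 5 - (recordP n : ℝ) / (recordQ n : ℝ)| < 1 / (q : ℝ) ^ γ :=
  record_exponent_of_sound_tail (soundList_of_all_ok2 hok) hch hγ0 hγ

end BrickAtlas

end Summit.KontsevichZagierPeriods.Zeta5Search.RecordRay
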